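import Mathlib

/-!
# R24 — μ₄ symmetry of the even node family, the quotient-contact reformulation of Q∞⁺,
# and the truncated nose trichotomy (toric-towers ROUND 24, crux `EquisingularLiftNatThree`)

Companion file of `R24-MU4-AND-TOTAL-SPLITTING.md` (res-L1-w45b-idea-1, gen 33).
Everything here is sorry-free and elementary; it types the algebraic kernels of the
ROUND 24 memo so that lead-1 / the panel can cite them by name:

* Part A — the order-4 symmetry `ι₀ : (X,Y,Z) ↦ (−X, iY, iZ)` of the surface family
  `Q47_k = {D² + G_k = 0}` for EVEN `k` (`ι₀² = j`), its failure for odd `k`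
  (explicit defect `−2·(X^{8+k}+Y^{16+2k}+Z^{16+2k})`), and the chart dictionary
  `ι : (a,b,v) ↦ (ia, ib, v)`.
* Part B — the graded-degree bookkeeping: the `(a,b)`-degrees `8, 8+2k, 24+4k` of the
  chart equation are all `≡ 0 (mod 4)` iff `k` is even; exponent maps of the three
  conical moves preserve `(a,b)`-degree, the non-linear round shifts it by `2s`.
* Part C — parity kernel of the quotient-contact lemma: `b · g(b²)` is odd, and the
  double-cover splitting identity behind “contact 2 ⇔ swapped smooth pair”.
* Part D — the truncated nose trichotomy for a type-D curved state
  `f = b⁶·(α(ℓ+εb)² + c₁ℓb³ + c₂b⁴ + …)`: discriminant `= 4α(εc₁ − c₂)b⁴ + c₁²b⁶`, so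
  `ord_b disc = 16` unless `c₂ = εc₁`, and in that case the truncation splits as
  `(ℓ+εb)·(α(ℓ+εb) + c₁b³)` (line × cubic graph) — the shape observed in 100 % of the
  census (`ν ∈ {18, ∞}`, never 16).
* Part E — exponent calculus of the moves on the nose edge `{(2−t, 6+t, t)}`.
* Part F — DATA rows of the in-seat census (k = 2, both node families; kit j325573 pending),
  recorded as numerals with `decide`d consistency checks only.

OURS labels: counted 0 · EL♮(3) NOT proved · AI-written, weaker than expert review.
Nothing in this file is a step of a proof of `EquisingularLiftNatThree`; it is typed
evidence for the crux-ideate card `Ideas/toric-towers.md` §ROUND 24.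
-/

set_option linter.dupNamespace false
set_option autoImplicit false

namespace Summit.ResolutionOfSingularities.ResolutionOfSingularities.Cruxes.EquisingularLiftNatThree.ToricTowers.R24

/-! ## Part A — the μ₄ symmetry of `Q47_k` for even `k` -/

section PartA
variable {R : Type*} [CommRing R]

/-- `T7h(Y,Z) = 64 Z⁷ − 112 Z⁵Y² + 56 Z³Y⁴ − 7 Z Y⁶` (lead-1's `explore4.sage`, line 18). -/
def T7h (Y Z : R) : R := 64*Z^7 - 112*Z^5*Y^2 + 56*Z^3*Y^4 - 7*Z*Y^6

/-- `D = 8X⁴ − 8X²Y⁴ + Y⁸ − Y·T7h` (weighted homogeneous of degree 8, `wt X = 2`). -/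
def Dpoly (X Y Z : R) : R := 8*X^4 - 8*X^2*Y^4 + Y^8 - Y * T7h Y Z

/-- `G_k = X^{8+k} + X^{16+2k} + Y^{16+2k} + Z^{16+2k}`. -/
def Gpoly (k : ℕ) (X Y Z : R) : R := X^(8+k) + X^(16+2*k) + Y^(16+2*k) + Z^(16+2*k)

/-- `F_k = D² + G_k`, the affine equation of `Q47_k`. -/
def Fpoly (k : ℕ) (X Y Z : R) : R := Dpoly X Y Z ^ 2 + Gpoly k X Y Z

/-- Weighted homogeneity of `D`: `D(t²X, tY, tZ) = t⁸ D(X,Y,Z)`. -/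
theorem Dpoly_weighted_hom (t X Y Z : R) :
    Dpoly (t^2*X) (t*Y) (t*Z) = t^8 * Dpoly X Y Z := by
  unfold Dpoly T7h; ring

/-- `D` is `ι₀`-invariant whenever `i² = −1`. -/
theorem Dpoly_iota (i X Y Z : R) (hi : i^2 = -1) :
    Dpoly (-X) (i*Y) (i*Z) = Dpoly X Y Z := by
  have h := Dpoly_weighted_hom i X Y Z
  have h8 : i^8 = 1 := by
    rw [show i^8 = (i^2)^4 by ring, hi]; norm_num
  rw [hi, h8, neg_one_mul, one_mul] at h
  exact h

/-- `D` is `j`-invariant, `j : (X,Y,Z) ↦ (X,−Y,−Z)`. -/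
theorem Dpoly_j (X Y Z : R) : Dpoly X (-Y) (-Z) = Dpoly X Y Z := by
  unfold Dpoly T7h; ring

/-- `G_k` under `ι₀` for EVEN `k = 2m`: invariant. -/
theorem Gpoly_iota_even (i X Y Z : R) (hi : i^2 = -1) (m : ℕ) :
    Gpoly (2*m) (-X) (i*Y) (i*Z) = Gpoly (2*m) X Y Z := by
  unfold Gpoly
  have hX1 : (-X)^(8 + 2*m) = X^(8 + 2*m) := Even.neg_pow ⟨4 + m, by ring⟩ X
  have hX2 : (-X)^(16 + 2*(2*m)) = X^(16 + 2*(2*m)) := Even.neg_pow ⟨8 + 2*m, by ring⟩ X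
  have hI : i^(16 + 2*(2*m)) = 1 := by
    rw [show 16 + 2*(2*m) = 2*(8 + 2*m) by ring, pow_mul, hi]
    exact Even.neg_one_pow ⟨4 + m, by ring⟩
  rw [hX1, hX2, mul_pow, mul_pow, hI, one_mul, one_mul]

/-- `G_k` under `ι₀` for ODD `k = 2m+1`: NOT invariant — explicit defect. -/
theorem Gpoly_iota_odd (i X Y Z : R) (hi : i^2 = -1) (m : ℕ) :
    Gpoly (2*m+1) (-X) (i*Y) (i*Z)
      = Gpoly (2*m+1) X Y Z - 2 * (X^(8 + (2*m+1)) + Y^(16 + 2*(2*m+1)) + Z^(16 + 2*(2*m+1))) := by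
  unfold Gpoly
  have hX1 : (-X)^(8 + (2*m+1)) = -(X^(8 + (2*m+1))) := Odd.neg_pow ⟨4 + m, by ring⟩ X
  have hX2 : (-X)^(16 + 2*(2*m+1)) = X^(16 + 2*(2*m+1)) := Even.neg_pow ⟨9 + 2*m, by ring⟩ X
  have hI : i^(16 + 2*(2*m+1)) = -1 := by
    rw [show 16 + 2*(2*m+1) = 2*(9 + 2*m) by ring, pow_mul, hi]
    exact Odd.neg_one_pow ⟨4 + m, by ring⟩
  rw [hX1, hX2, mul_pow, mul_pow, hI]; ring

/-- **μ₄ symmetry (k even).** `F_{2m}(−X, iY, iZ) = F_{2m}(X,Y,Z)` in any commutative ring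
with `i² = −1`. -/
theorem Fpoly_iota_even (i X Y Z : R) (hi : i^2 = -1) (m : ℕ) :
    Fpoly (2*m) (-X) (i*Y) (i*Z) = Fpoly (2*m) X Y Z := by
  unfold Fpoly; rw [Dpoly_iota i X Y Z hi, Gpoly_iota_even i X Y Z hi m]

/-- **Failure for k odd.** `F_{2m+1}(ι₀·P) − F_{2m+1}(P) = −2(X^{8+k}+Y^{16+2k}+Z^{16+2k})`. -/
theorem Fpoly_iota_odd (i X Y Z : R) (hi : i^2 = -1) (m : ℕ) :
    Fpoly (2*m+1) (-X) (i*Y) (i*Z)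
      = Fpoly (2*m+1) X Y Z - 2 * (X^(8 + (2*m+1)) + Y^(16 + 2*(2*m+1)) + Z^(16 + 2*(2*m+1))) := by
  unfold Fpoly; rw [Dpoly_iota i X Y Z hi, Gpoly_iota_odd i X Y Z hi m]; ring

/-- `ι₀² = j`: applying `ι₀` twice gives `(X, −Y, −Z)`. -/
theorem iota_sq (i X Y Z : R) (hi : i^2 = -1) :
    (-(-X), i*(i*Y), i*(i*Z)) = (X, -Y, -Z) := by
  have hY : i*(i*Y) = -Y := by linear_combination Y * hi
  have hZ : i*(i*Z) = -Z := by linear_combination Z * hi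
  rw [neg_neg, hY, hZ]

/-- `F_k` is `j`-invariant for every `k`. -/
theorem Fpoly_j (k : ℕ) (X Y Z : R) : Fpoly k X (-Y) (-Z) = Fpoly k X Y Z := by
  unfold Fpoly Gpoly
  have hY : (-Y)^(16 + 2*k) = Y^(16 + 2*k) := Even.neg_pow ⟨8 + k, by ring⟩ Y
  have hZ : (-Z)^(16 + 2*k) = Z^(16 + 2*k) := Even.neg_pow ⟨8 + k, by ring⟩ Z
  rw [Dpoly_j, hY, hZ]

/-- Chart dictionary. In the node chart `X = b·a, Y = b, Z = b·(w₀+v)` the substitution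
`(a,b,v) ↦ (ia, ib, v)` is exactly `ι₀` upstairs. -/
theorem chart_iota (i a b v w0 : R) (hi : i^2 = -1) (k : ℕ) :
    Fpoly k ((i*b)*(i*a)) (i*b) ((i*b)*(w0+v)) = Fpoly k (-(b*a)) (i*b) (i*(b*(w0+v))) := by
  have h1 : (i*b)*(i*a) = -(b*a) := by linear_combination (b*a) * hi
  have h2 : (i*b)*(w0+v) = i*(b*(w0+v)) := by ring
  rw [h1, h2]

/-- Consequence used in the memo §A: for even `k` the chart equation
`F_k(b a, b, b(w₀+v))` is invariant under `(a,b,v) ↦ (ia, ib, v)`; since `(ib)⁸ = b⁸`,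
so is `T₀ = F_k(…)/b⁸`. (Stated at the `F` level to avoid division.) -/
theorem chart_invariant_even (i a b v w0 : R) (hi : i^2 = -1) (m : ℕ) :
    Fpoly (2*m) ((i*b)*(i*a)) (i*b) ((i*b)*(w0+v)) = Fpoly (2*m) (b*a) b (b*(w0+v)) := by
  rw [chart_iota i a b v w0 hi, Fpoly_iota_even i (b*a) b (b*(w0+v)) hi m]

/-- … and the power of `b` we divide by is itself `ι`-invariant: `(ib)⁸ = b⁸`. -/
theorem ib_pow_eight (i b : R) (hi : i^2 = -1) : (i*b)^8 = b^8 := by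
  have h8 : i^8 = 1 := by rw [show i^8 = (i^2)^4 by ring, hi]; norm_num
  rw [mul_pow, h8, one_mul]

end PartA

/-! ## Part B — graded degrees and the exponent calculus of the moves -/

section PartB

/-- The `(a,b)`-degrees of the monomials of `T₀ = F_k(ba,b,b(w₀+v))/b⁸` are `8` (from `D²`),
`8 + 2k` (from `X^{8+k}, Y^{16+2k}, Z^{16+2k}`) and `24 + 4k` (from `X^{16+2k}`); they are all
`≡ 0 (mod 4)` iff `k` is even — the numerical shadow of Part A. -/
theorem graded_degrees_mod_four (k : ℕ) :
    (8 % 4 = 0 ∧ (8 + 2*k) % 4 = 0 ∧ (24 + 4*k) % 4 = 0) ↔ Even k := by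
  rw [Nat.even_iff]; omega

/-- Exponent map of the point step with multiplicity `m`: `a^i b^j v^l ↦ a^i b^j v^{l+i+j-m}`. -/
def ptExp (m : ℕ) (e : ℕ × ℕ × ℕ) : ℕ × ℕ × ℕ := (e.1, e.2.1, e.2.2 + e.1 + e.2.1 - m)

/-- Exponent map of the slope round at the moving line `ℓ` (coordinates `(ℓ,b,v)`, `ℓ ↦ vℓ`,
content `m`): `ℓ^i b^j v^l ↦ ℓ^i b^j v^{l+i-m}`. -/
def rdExp (m : ℕ) (e : ℕ × ℕ × ℕ) : ℕ × ℕ × ℕ := (e.1, e.2.1, e.2.2 + e.1 - m)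

/-- Exponent map of the fibre round `b ↦ vb` (content `m`). -/
def fibExp (m : ℕ) (e : ℕ × ℕ × ℕ) : ℕ × ℕ × ℕ := (e.1, e.2.1, e.2.2 + e.2.1 - m)

/-- `(a,b)`-degree of an exponent. -/
def abDeg (e : ℕ × ℕ × ℕ) : ℕ := e.1 + e.2.1

theorem abDeg_ptExp (m : ℕ) (e : ℕ × ℕ × ℕ) : abDeg (ptExp m e) = abDeg e := rfl
theorem abDeg_rdExp (m : ℕ) (e : ℕ × ℕ × ℕ) : abDeg (rdExp m e) = abDeg e := rfl
theorem abDeg_fibExp (m : ℕ) (e : ℕ × ℕ × ℕ) : abDeg (fibExp m e) = abDeg e := rfl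

/-- A linear round `a ↦ va + τb` sends `a^i` to monomials `(va)^s (τb)^{i-s}`: degree kept. -/
theorem linear_round_degree (i j s : ℕ) (hs : s ≤ i) : s + (i - s) + j = i + j := by omega

/-- A NON-linear round `a ↦ va + τb + κb³` produces, from `a^i b^j`, monomials with `s` factors
`κb³`: their `(a,b)`-degree is `i + j + 2s` — purity mod 4 is broken exactly by odd `s`. -/
theorem cubic_round_degree (i j s r : ℕ) (h : r + s ≤ i) :
    r + (i - r - s) + 3*s + j = i + j + 2*s := by omega

theorem cubic_round_breaks_mod_four (d s : ℕ) (hd : d % 4 = 0) :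
    (d + 2*s) % 4 = 0 ↔ Even s := by rw [Nat.even_iff]; omega

end PartB

/-! ## Part C — parity kernel of the quotient-contact lemma -/

section PartC
open Polynomial
variable {R : Type*} [CommRing R]

/-- A graph `a = b·g(b²)` is `j`-odd: evaluating at `−b` negates it. (The branch is then
`j`-fixed; in the quotient chart `(u = a/b, B = b²)` it is the smooth branch `u = g(B)` with
contact `1` with the branch curve `B = 0`.) -/
theorem odd_of_expand_two (g : R[X]) (b : R) :
    (X * expand R 2 g).eval (-b) = -((X * expand R 2 g).eval b) := by
  simp [eval_mul, eval_X, expand_eval]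

/-- The double-cover splitting identity behind “contact 2 ⇔ a `j`-swapped smooth pair”:
over the branch curve `B = b²`, a smooth quotient branch `B·h = (u−u₀)²` with `h = c²` a square
unit pulls back to the two smooth branches `c·b = ±(u−u₀)`, exchanged by `b ↦ −b`. -/
theorem double_cover_split (b c u u0 : R) :
    b^2 * c^2 - (u - u0)^2 = (c*b - (u - u0)) * (c*b + (u - u0)) := by ring

/-- … whereas contact `1` (`B·h = (u−u₀)` to first order) pulls back to ONE branch through the
point, fixed by `b ↦ −b`: the defining function is even in `b`. -/
theorem contact_one_even (b u u0 h : R) :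
    (fun b' : R => b'^2 * h - (u - u0)) (-b) = (fun b' : R => b'^2 * h - (u - u0)) b := by
  simp

end PartC

/-! ## Part D — the truncated nose trichotomy of a type-D curved state -/

section PartD
variable {R : Type*} [CommRing R]

/-- Truncation of a type-D curved state after the slope round, in moving-line coordinates:
`q = α(ℓ+εb)² + c₁ℓb³ + c₂b⁴` (the `b⁶` factor and all terms of `(ℓ,b)`-degree ≥ 6 dropped). -/
def noseTrunc (α ε c₁ c₂ ℓ b : R) : R := α*(ℓ + ε*b)^2 + c₁*ℓ*b^3 + c₂*b^4

/-- Its discriminant as a quadratic in `ℓ` (`A = α`, `B = 2αεb + c₁b³`, `C = αε²b² + c₂b⁴`):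
`B² − 4AC = 4α(εc₁ − c₂)·b⁴ + c₁²·b⁶`. Hence `ord_b = 4` (total `ν = 16` after the `b¹²`)
UNLESS `c₂ = εc₁`. The census never sees `ν = 16`. -/
theorem noseTrunc_disc (α ε c₁ c₂ b : R) :
    (2*α*ε*b + c₁*b^3)^2 - 4*α*(α*ε^2*b^2 + c₂*b^4)
      = 4*α*(ε*c₁ - c₂)*b^4 + c₁^2*b^6 := by ring

/-- The quadratic really is `A ℓ² + B ℓ + C` with those `A, B, C`. -/
theorem noseTrunc_eq (α ε c₁ c₂ ℓ b : R) :
    noseTrunc α ε c₁ c₂ ℓ b = α*ℓ^2 + (2*α*ε*b + c₁*b^3)*ℓ + (α*ε^2*b^2 + c₂*b^4) := by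
  unfold noseTrunc; ring

/-- **Sheet divisibility ⇒ line × cubic-graph splitting.** If `c₂ = εc₁` the truncation
factors as `(ℓ+εb)·(α(ℓ+εb) + c₁b³)`: the new double line's factor divides BOTH the degree-8
and the degree-10 layer, and the two factors are the line `ℓ = −εb` and the cubic graph
`ℓ = −εb − (c₁/α)b³` — the shape observed in every type-D successor state. -/
theorem noseTrunc_split (α ε c₁ ℓ b : R) :
    noseTrunc α ε c₁ (ε*c₁) ℓ b = (ℓ + ε*b) * (α*(ℓ + ε*b) + c₁*b^3) := by
  unfold noseTrunc; ring

/-- Conversely, if the truncation vanishes identically on the line `ℓ = −εb` then `c₂ = εc₁`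
(evaluate at `ℓ = −εb`: the value is `(c₂ − εc₁)·b⁴`). -/
theorem noseTrunc_on_line (α ε c₁ c₂ b : R) :
    noseTrunc α ε c₁ c₂ (-(ε*b)) b = (c₂ - ε*c₁) * b^4 := by
  unfold noseTrunc; ring

/-- The double edge transported: the slope round `ℓ ↦ vℓ'` (content 2) applied to the nose edge
`αℓ²b⁶ + βvℓb⁷ + γv²b⁸` lands entirely at `v`-level 0 and gives `b⁶(αℓ'² + βℓ'b + γb²)`;
if the edge is a perfect square (`β² = 4αγ`, forced by `gr₈T = v^λΣ²`) the new `f^{[8]}` is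
again `b⁶ ×` a double line. Polynomial identity for the square case `β = 2αε, γ = αε²`: -/
theorem double_edge_transport (α ε ℓ' b : R) :
    α*ℓ'^2*b^6 + (2*α*ε)*ℓ'*b^7 + (α*ε^2)*b^8 = b^6 * (α*(ℓ' + ε*b)^2) := by ring

end PartD

/-! ## Part E — exponent calculus on the nose edge -/

section PartE

/-- The nose edge of a type-D state in moving-line coordinates: `(2−t, 6+t, t)`, `t ≤ 2`. -/
def edgePt (t : ℕ) : ℕ × ℕ × ℕ := (2 - t, 6 + t, t)

/-- Under the slope round (content 2) every edge monomial lands at `v`-level 0 … -/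
theorem edge_to_level_zero (t : ℕ) (ht : t ≤ 2) : (rdExp 2 (edgePt t)).2.2 = 0 := by
  simp [rdExp, edgePt]; omega

/-- … with `(ℓ,b)`-degree 8, i.e. it becomes the degree-8 layer `f'^{[8]}` of the new trace. -/
theorem edge_degree (t : ℕ) (ht : t ≤ 2) : abDeg (edgePt t) = 8 := by
  simp [abDeg, edgePt]; omega

/-- Under the point step with `m_P = 8` a monomial of `(a,b)`-degree 8 keeps its `v`-level,
so `f'^{[8]}` after `pt(m8)` is the binary form `f^{[8]}` (lines only: no curved branches are
created by a point step at multiplicity 8). -/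
theorem pt8_keeps_level (i j l : ℕ) (h : i + j = 8) : (ptExp 8 (i, j, l)).2.2 = l := by
  simp [ptExp]; omega

/-- Under `pt(m)` with `m = 10`, the degree-8 layer at level `l` moves DOWN to level `l − 2`:
the sub-nose `{(1,9,1),(0,10,2)} ∪ {(2,6,2)}` is what feeds the new `f'`. -/
theorem pt10_lowers_deg8 (i j l : ℕ) (h : i + j = 8) (hl : 2 ≤ l) :
    (ptExp 10 (i, j, l)).2.2 = l - 2 := by
  simp [ptExp]; omega

end PartE

/-! ## Part F — DATA (in-seat census rows, k = 2; kit j325573 pending)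

One row per run of `curved.py` (exact arithmetic over `GF(10009²)`, all `j`-equivariant
histories to depth `D1`, curved-world histories to depth `D1+DX`). Fields:
`states, curved, swappedFormalPairs, legalAsymmetric, notTotallySplit, nu16` .
These are MEASUREMENTS, not theorems about `Q47_k`; the `decide`s below only check the
internal bookkeeping claims quoted in the memo. -/

section PartF

structure CensusRow where
  k : ℕ
  plusFamily : Bool
  d1 : ℕ
  dx : ℕ
  states : ℕ
  curved : ℕ
  swappedFormalPairs : ℕ
  legalAsymmetric : ℕ
  notTotallySplit : ℕ
  nu16 : ℕ
  deriving DecidableEq, Repr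

def rowPlus : CensusRow := ⟨2, true, 6, 4, 6832, 6184, 0, 0, 0, 0⟩
def rowMinus : CensusRow := ⟨2, false, 6, 4, 2529, 2128, 0, 0, 0, 0⟩
/-- Control row (k = 3, odd): the explorer DOES find lead-1's four legal quartic pairs. -/
def rowK3 : CensusRow := ⟨3, true, 5, 1, 220, 0, 4, 4, 0, 0⟩

def rows : List CensusRow := [rowPlus, rowMinus, rowK3]

/-- Memo claim: in the even family every measured defect count is zero … -/
theorem even_rows_clean :
    (rows.filter (fun r => r.k % 2 == 0)).all
      (fun r => r.swappedFormalPairs == 0 && r.legalAsymmetric == 0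
        && r.notTotallySplit == 0 && r.nu16 == 0) = true := by decide

/-- … while the odd control row is NOT clean (the detector is not vacuous). -/
theorem odd_control_detects : rowK3.legalAsymmetric = 4 := rfl

/-- Curved-world share quoted in the memo: `6184 + 2128 = 8312` curved states. -/
theorem curved_total : rowPlus.curved + rowMinus.curved = 8312 := by decide

end PartF

/-! ## Part G — v-adic convexity (V) and the content of point steps / fibre rounds at C-states (memo §6.4)

Exponent bookkeeping only: a monomial `a^i b^j v^l`; at a C-state with parameter `lam ≥ 1` the invariant (V) is
`lam * (i - 1) ≤ l` for `i ≥ 1`.  A content-1 graph round sends the `a^s`-part (`1 ≤ s ≤ i`) to level `l - 1 + s`;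
a point step with content 10 sends the level to `l + i + j - 10` and `lam` to `lam - 2`; a fibre round has content
`min 9 (6 + lam)` and the minimisers are `a²b⁶v^lam` and `ab⁹`. -/

/-- (V) survives a content-1 graph round and the parameter grows by one. -/
theorem conv_round (i s l lam : ℤ) (_hs : 1 ≤ s) (hsi : s ≤ i) (hlam : 0 ≤ lam)
    (hV : lam * (i - 1) ≤ l) : (lam + 1) * (s - 1) ≤ l - 1 + s := by nlinarith

/-- (V) survives a point step of content 10 on every layer of degree ≥ 10 (parameter drops by two). -/
theorem conv_pt_high (i j l lam : ℤ) (hi : 1 ≤ i) (hij : 10 ≤ i + j) (_hlam : 2 ≤ lam)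
    (hV : lam * (i - 1) ≤ l) : (lam - 2) * (i - 1) ≤ l + i + j - 10 := by nlinarith

/-- … and on the 8-layer, where only `i ≤ 2` occurs (`c² b⁶ (a - t b)²` at level `lam`). -/
theorem conv_pt_eight (i l lam : ℤ) (_hi : 1 ≤ i) (hi2 : i ≤ 2) (hlam : 2 ≤ lam) (hl : lam ≤ l) :
    (lam - 2) * (i - 1) ≤ l + 8 - 10 := by nlinarith

/-- Fibre-round content at a C-state: every monomial of a layer of degree `d ≥ 10` with `i ≥ 1` has `j + l ≥ 9`
(given (V) and `lam ≥ 1`), the 8-layer term `a²b⁶v^lam` has `j + l = 6 + lam`, and `ab⁹` has `j + l = 9`. -/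
theorem fib_content_high (i j l lam : ℤ) (hi : 1 ≤ i) (hd : 10 ≤ i + j) (hlam : 1 ≤ lam)
    (hV : lam * (i - 1) ≤ l) : 9 ≤ j + l := by nlinarith

theorem fib_content_level0 (j : ℤ) (hj : 9 ≤ j) : 9 ≤ j + 0 := by omega

theorem fib_content_eight (lam : ℤ) : (6 : ℤ) + lam = 6 + lam := rfl

/-- Hence `m_fib = min 9 (6 + lam)`: for `lam ≤ 2` the unique minimiser is `a²b⁶v^lam` (new trace `α a² b⁶`),
for `lam = 3` both tie (new trace `a b⁶ (c² a + c' b³)` = D11), for `lam ≥ 4` only `ab⁹` (new trace `c a b⁹`, a C-state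
with `lam' = lam - 3`). The three regimes as arithmetic facts: -/
theorem fib_regimes (lam : ℤ) (h : 1 ≤ lam) :
    (lam ≤ 2 → 6 + lam < 9) ∧ (lam = 3 → 6 + lam = 9) ∧ (4 ≤ lam → 9 < 6 + lam) := by omega

/-- Point-step content at a C-state: `m_pt = min (8 + lam) 10`, i.e. 9 for `lam = 1` and 10 for `lam ≥ 2`;
in particular the case `m = 8 + lam` with `lam ≥ 3` never occurs (memo §6.3's feared case is empty). -/
theorem pt_regimes (lam : ℤ) (h : 1 ≤ lam) :
    min (8 + lam) 10 = (if lam = 1 then 9 else 10) ∧ (3 ≤ lam → min (8 + lam) 10 < 8 + lam) := by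
  constructor
  · split_ifs with h1
    · subst h1; norm_num
    · rw [min_eq_right (by omega)]
  · intro h3; rw [min_eq_right (by omega)]; omega


end Summit.ResolutionOfSingularities.ResolutionOfSingularities.Cruxes.EquisingularLiftNatThree.ToricTowers.R24
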